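import Mathlib
import HarnessLib
import Summits.HubbardSuperconductivity.HubbardSuperconductivity.Theorems.KLProgrammeKLRegimeSplitTwoLegAngular
import Summits.HubbardSuperconductivity.HubbardSuperconductivity.Theorems.KLProgrammeKLRegimeCountertermLatticeAngleNet

/-!
# Route `KLProgramme` — child `KLRegimeCounterterm` (V9+: `CountertermP2 klPredsV9 klWindowC`): the GRID READING of the renormalisation
# condition — control of the local part at the flat-tube LATTICE ANGLES plus the angular modulus (E3g) gives `RenormalisedAtF` at EVERY angle
# (seat hubbard-kl-k3c3-p3; consumer side of defect Δ18)

With (E3g) `TwoLegAngularG` in the two-leg slot (`…SplitTwoLegAngular`, bundle V9) and the lattice-angle net on the analysis window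
(`…CountertermLatticeAngleNet`: for `μ ∈ klWindowC`, `L ≥ 503`, every direction is within `24/L` (mod `2π`) of `momentumAngle L k` for a
lattice momentum `k` with `|nambuXi L μ k| ≤ klFlatR`), the one-volume construction of child 2 only has to control the local part
`ν_n(K)` at the flat-tube lattice angles — where the G-objects read it exactly.  This module states that passage once:

* §1 `klFermiPoint` and `klLocalPart` are `2π`-periodic in the angle (`klFermiPoint_periodic`, `klLocalPart_periodic`);
* §2 **`abs_klLocalPart_le_of_grid`**: `|ν_n(K)(momentumAngle L k)| ≤ A` for every flat-tube `k` ∧ (E3g) ⇒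
  `|ν_n(K)(θ)| ≤ A + angBar G Q R U (nScales β) 1 · (24/L)` for EVERY `θ`; hence **`renormalisedAtF_of_grid`** (grid bound + slack inside
  the quadratic tolerance ⇒ `RenormalisedAtF`) and the half-tolerance form `abs_klLocalPart_le_half_of_grid` used by `CtOneVolume`.

Proofs only; nothing is asserted about the Hubbard model.  References: HOME/hubbard-kl-k3c3-p3/DEFECT-ANGULAR.md §5; cell gate-hubbard-kl
STATUS 2026-08-26 l.972/l.979 (Δ18 ruling, (E3g) of record).
-/

noncomputable section

namespace Summit.HubbardSuperconductivity.HubbardSuperconductivity.Theorems.KLRegimeSplit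

set_option linter.dupNamespace false -- summit = problem name (single-conjunct summit), D-0017

open Real Set
open Literature.MathematicalPhysics.QuantumLattice Literature.Probability.LatticeModels
open Summit.HubbardSuperconductivity.HubbardSuperconductivity.Theorems.KLProgrammeLegKernels
open Summit.HubbardSuperconductivity.HubbardSuperconductivity.Theorems.PerturbedFermiCurve

/-! ## §1 Periodicity in the angle -/

/-- The frame's Fermi point is `2π`-periodic in the angle. -/
theorem klFermiPoint_periodic (μ : ℝ) (K : TrigPolyC4v) : Function.Periodic (klFermiPoint μ K) (2 * π) := by
  intro θ
  unfold klFermiPoint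
  rw [perturbedFermiRadius_add_two_pi, dir_add_two_pi]

section Model

variable {L M : ℕ} [NeZero L] [NeZero M]

/-- The local part is `2π`-periodic in the angle. -/
theorem klLocalPart_periodic (β U μ : ℝ) (K : TrigPolyC4v) (n : ℕ) :
    Function.Periodic (klLocalPart L M β U μ K n) (2 * π) := by
  intro θ
  unfold klLocalPart
  rw [klFermiPoint_periodic μ K θ]

/-- The local part at `θ − 2πm` equals the local part at `θ`. -/
theorem klLocalPart_sub_int_mul_two_pi (β U μ : ℝ) (K : TrigPolyC4v) (n : ℕ) (θ : ℝ) (m : ℤ) :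
    klLocalPart L M β U μ K n (θ - 2 * π * m) = klLocalPart L M β U μ K n θ := by
  have h := (klLocalPart_periodic (L := L) (M := M) β U μ K n).sub_int_mul_eq m (x := θ)
  rw [show θ - 2 * π * m = θ - (m : ℝ) * (2 * π) by ring]
  exact h

/-! ## §2 From the flat-tube lattice angles to every angle -/

/-- **Grid reading of the local part.**  On the analysis window (`μ ∈ klWindowC`) at a volume `L ≥ 503`: if the scale-`n` local part of
`K` is bounded by `A` at the polar angle of every flat-tube lattice momentum (`|nambuXi L μ k| ≤ klFlatR`) and satisfies (E3g), then it is
bounded by `A + angBar G Q R U (nScales β) 1 · (24/L)` at EVERY angle. -/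
theorem abs_klLocalPart_le_of_grid {G : GeoConsts} {Q : EngConsts} {R : RenConsts} {β U μ : ℝ} {K : TrigPolyC4v} {n : ℕ}
    (hμ : μ ∈ klWindowC) (hL : 503 ≤ L) (hang : TwoLegAngularG L M G Q R β U μ K n) {A : ℝ}
    (hgrid : ∀ k : TorusSite 2 L, |nambuXi L μ k| ≤ klFlatR → |klLocalPart L M β U μ K n (momentumAngle L k)| ≤ A) (θ : ℝ) :
    |klLocalPart L M β U μ K n θ| ≤ A + angBar G Q R U (nScales β) 1 * (24 / L) := by
  -- the net: flat-tube lattice angles shifted by `2πℤ`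
  refine hang.abs_le_of_net (S := {a | ∃ k : TorusSite 2 L, ∃ m : ℤ, |nambuXi L μ k| ≤ klFlatR ∧ a = momentumAngle L k - 2 * π * m})
    (A := A) (δ := 24 / L) ?_ ?_ θ
  · rintro a ⟨k, m, hk, rfl⟩
    rw [klLocalPart_sub_int_mul_two_pi]
    exact hgrid k hk
  · intro θ'
    obtain ⟨k, hk, m, hm⟩ := exists_flatTube_latticeAngle_near hμ L hL θ'
    refine ⟨momentumAngle L k - 2 * π * m, ⟨k, m, hk, rfl⟩, ?_⟩
    rw [show θ' - (momentumAngle L k - 2 * π * m) = -(momentumAngle L k - θ' - 2 * π * m) by ring, abs_neg]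
    exact hm

/-- **`RenormalisedAtF` from the grid.**  Grid bound `A` on the flat tube, (E3g), and `A + angBar…1·(24/L) ≤ cr·|U|·Λ_n²/e₀` give the
renormalisation predicate at scale `n` (every real angle). -/
theorem renormalisedAtF_of_grid {G : GeoConsts} {Q : EngConsts} {R : RenConsts} {β U μ : ℝ} {K : TrigPolyC4v} {n : ℕ}
    (hμ : μ ∈ klWindowC) (hL : 503 ≤ L) (hang : TwoLegAngularG L M G Q R β U μ K n) {A : ℝ}
    (hgrid : ∀ k : TorusSite 2 L, |nambuXi L μ k| ≤ klFlatR → |klLocalPart L M β U μ K n (momentumAngle L k)| ≤ A)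
    (htol : A + angBar G Q R U (nScales β) 1 * (24 / L) ≤ R.cr * |U| * klScale klE0 n ^ 2 / klE0) :
    RenormalisedAtF L M β U μ K R n := fun θ =>
  (abs_klLocalPart_le_of_grid hμ hL hang hgrid θ).trans htol

/-- **Half-tolerance form (the shape `CtOneVolume` asks at the construction volume).**  Grid bound `A`, (E3g), and
`A + angBar…1·(24/L) ≤ t/2` give `|ν_n(K)(θ)| ≤ t/2` at every angle. -/
theorem abs_klLocalPart_le_half_of_grid {G : GeoConsts} {Q : EngConsts} {R : RenConsts} {β U μ : ℝ} {K : TrigPolyC4v} {n : ℕ}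
    (hμ : μ ∈ klWindowC) (hL : 503 ≤ L) (hang : TwoLegAngularG L M G Q R β U μ K n) {A t : ℝ}
    (hgrid : ∀ k : TorusSite 2 L, |nambuXi L μ k| ≤ klFlatR → |klLocalPart L M β U μ K n (momentumAngle L k)| ≤ A)
    (htol : A + angBar G Q R U (nScales β) 1 * (24 / L) ≤ t / 2) :
    ∀ θ : ℝ, |klLocalPart L M β U μ K n θ| ≤ t / 2 := fun θ =>
  (abs_klLocalPart_le_of_grid hμ hL hang hgrid θ).trans htol

/-- **Choice of the volume for the angular slack.**  For every `ε > 0` and every slack constant `Λ₁` there is `L₁ ≥ 503` such that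
`Λ₁·(24/L) ≤ ε` for all `L ≥ L₁` — the (E3g) part of the «`L₀` large» line of `CtOneVolume` (after `β, U`, hence after `Λ₁ = angBar…1`). -/
theorem exists_nat_angularSlack_le {Λ₁ ε : ℝ} (hε : 0 < ε) :
    ∃ L₁ : ℕ, 503 ≤ L₁ ∧ ∀ L : ℕ, L₁ ≤ L → Λ₁ * (24 / (L : ℝ)) ≤ ε := by
  obtain ⟨N, hN⟩ := exists_nat_gt (24 * Λ₁ / ε)
  refine ⟨max 503 N, le_max_left _ _, fun L hL => ?_⟩
  have hNL : (N : ℝ) ≤ L := by exact_mod_cast (le_max_right _ _).trans hL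
  have hLpos : (0 : ℝ) < L := by
    have : (503 : ℝ) ≤ L := by exact_mod_cast (le_max_left _ _).trans hL
    linarith
  rw [mul_div_assoc', div_le_iff₀ hLpos]
  have : 24 * Λ₁ / ε < L := hN.trans_le hNL
  rw [div_lt_iff₀ hε] at this
  nlinarith

end Model

end Summit.HubbardSuperconductivity.HubbardSuperconductivity.Theorems.KLRegimeSplit

end
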